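import Summits.NavierStokesRegularity.NavierStokesRegularity.Theses.PalasekTowerBreakdown
import Summits.NavierStokesRegularity.NavierStokesRegularity.Theorems.EpisodeInduction.Negative.ShiftStage
import Summits.NavierStokesRegularity.FluidComputer.PalasekTowerClayBridgeUniquenessHolds
import Summits.NavierStokesRegularity.FluidComputer.PalasekTowerHeredityRefutationWitnessesRung
import Literature.Analysis.FluidPDE.AxisymmetricNoSwirlGlobalHolds

/-!
# KJ-10 kernel: the GLOBAL-SOLUTION lever against the crux `EpisodeInduction` — no cap, no sign, no `hU`

Cell `ns-blowup`, seat `ns-blowup-refuter` (g12), K-row KJ-10 (tribunal T2 ∀-form supplement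
`t2-r3-forall-cap-supplement.md` 3eec0c4d45769a4d; refuter4 g3 K61 = the registrability row of record;
planner g18 dispositions STATUS l.3347 / l.3900 / l.4032). NEGATIVE-LANE support lemmas for the route item
`PalasekTowerBreakdown.EpisodeInduction` (:= `EpisodeInductionG`, stmt-NavierStokesRegularity-19178; split
into 19249 `HeredityAtOne` ∧ 19250 `HeredityFromTwo`). LABEL: refuter kernel certificate (E–C typing over
landed files; every input is a DISCHARGED theorem of the tree). WHAT THIS IS NOT: not Navier–Stokes
evidence — no schedule, stage, design or tower is constructed; no `¬ EpisodeInductionG` is claimed; the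
existential premise of every lever below is EMPTY-IN-PRACTICE by the cell's own scoping numerics (K61 /
S-RING-1 j253937: co-signed no-swirl free amplification `μ ≤ 1.17`, P-RING-0 two-signed `≤ 1.42`, against
the level-1 floor ratio `Y₁/Y₀ = 256^{0.13} ≈ 2.056`).

THE POINT (what K61's «p441581 + a typed GS15 cap make the lever a short kernel job» still priced as a
cap): against the PARENT crux no speed cap and no sign condition on `ω_θ` is needed at all — GLOBAL
REGULARITY of ONE registered level-1 design suffices, and for the axisymmetric swirl-free class that
regularity (Ladyzhenskaya 1968 / Ukhovskii–Yudovich 1968) is the tree's THEOREM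
`axisymmetric_no_swirl_global_regularity_holds`; Tao's forced uniqueness `hU` is the tree's THEOREM
`tao_unconditional_uniqueness_velocity_forced_holds`. So:

* §1 `Realisation.not_exists_global_classical` — a realisation's design `(u(0), f)` has NO global
  finite-energy classical solution (`hU`-free form of `Realisation.not_exists_claySolution`);
  `Realisation.not_axisym_noSwirl_of_force_zero` — an UNFORCED realisation's datum is not axisymmetric
  without swirl (the register's twin of pub-fluidc's `NoAxisymNoSwirlWitness.not_axisym_noSwirl`).
* §2 `EpisodeInductionG.false_of_global_classical` / `not_episodeInductionG_of_global_design` — K2G plus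
  ONE registered level-1 stage of a pinned rigid quiet wide schedule whose design admits a global
  finite-energy classical solution is absurd (the tower `Realisation.ofEpisodes` glued by K2G from that
  stage is maximal at `T`, the global solution is continuous through `T`, uniqueness identifies them);
  `EpisodeInductionG.isEmpty_stage_of_noSwirl` / `not_episodeInductionG_of_noSwirl_design` — hence K2G
  EMPTIES the unforced axisymmetric swirl-free class at level 1 (two-signed `ω_θ` included: P-RING-0's
  head-on mirror families are in the premise class, not only K61's co-signed 𝒮);
  `EpisodeInductionG.isEmpty_unforced_stage_of_clayA` — and Clay (A) itself (the summit statement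
  `NavierStokesRegularity`) empties the whole UNFORCED design class under K2G.
* §3 `episodeInductionG_or_episodeBaseG`, `episodeInductionG_iff_not_episodeBaseG_of_global_designs` —
  the dichotomy of record one level up (`¬ K2G` proves the base item 19179) and T2's ∀-form point made
  kernel: if every registered level-1 design were globally regular, K2G would hold IFF VACUOUSLY
  (`↔ ¬ EpisodeBaseG`).
* §4 the same by the route's decl names (namespace `Summit.NavierStokesRegularity.PalasekTowerBreakdownNegative`:
  `palasekTowerBreakdown_not_episodeInduction_of_global_design`, `…_of_noSwirl_design`,
  `…_not_heredity_pair_of_noSwirl_design`).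

Filed as PLAIN negative lemmas (`--supports` 19178), NOT `--negative-modulo`: the premise «a registered
unforced no-swirl level-1 stage» is empty-in-practice (K61 (d), planner l.4032 (2)), so a HOLD would idle
the binders for a construction nobody will deliver; if a design seat ever registers a globally regular
design, `¬ EpisodeInduction` is the one-liner of §4 and the planner's banked repair (r4) applies.

References: O. A. Ladyzhenskaya, Zap. Naučn. Sem. LOMI 7 (1968); M. R. Ukhovskii, V. I. Yudovich,
J. Appl. Math. Mech. 32 (1968) — through P. G. Lemarié-Rieusset, *The Navier–Stokes Problem in the 21st
Century*, CRC 2016, Thm 10.4 (p. 285) [cite: LemarieRieusset2016, Thm 10.4 (p. 285)]; T. Tao, Anal. PDE 6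
(2013), Cor. 11.4 [cite: Tao2011, Cor. 11.4]; S. Palasek, arXiv:2605.13827 §4
[cite: Palasek2026ElementaryModel, §4]; C. Fefferman, Clay problem description (2006), (A)/(C)
[cite: FeffermanClay2006, (A)].
-/

noncomputable section

namespace Summit.NavierStokesRegularity.FluidComputer.PalasekTowerClayBridge

open Set MeasureTheory Filter Topology Function
open scoped ENNReal ContDiff NNReal
open Literature.Analysis.FluidPDE

/-! ## §1 A realisation's design is not globally solvable (`hU` discharged) -/

namespace Realisation

variable {ν : ℝ} {R : TowerRates} (W : Realisation ν R)

/-- **No global finite-energy classical solution shares a realisation's datum and force** — the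
`hU`-free form of `not_exists_claySolution` (Tao's forced Cor. 11.4 is the tree's theorem
`tao_unconditional_uniqueness_velocity_forced_holds`), in classical-on-`[0, ∞)` dress
(`isNavierStokesSolution_and_smooth_iff`). [cite: Tao2011, Cor. 11.4] -/
theorem not_exists_global_classical (hν : 0 < ν) :
    ¬ ∃ (v : ℝ → EuclideanSpace ℝ (Fin 3) → EuclideanSpace ℝ (Fin 3))
        (q : ℝ → EuclideanSpace ℝ (Fin 3) → ℝ),
        IsClassicalNSSolutionOn (Ici 0) ν W.f v q ∧ v 0 = W.u 0 ∧ HasBoundedEnergy v := by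
  rintro ⟨v, q, hcl, h0, hE⟩
  obtain ⟨hns, hv, hq⟩ := isNavierStokesSolution_and_smooth_iff.2 ⟨hcl, h0⟩
  exact W.not_exists_claySolution tao_unconditional_uniqueness_velocity_forced_holds hν
    ⟨v, q, hv, hq, hns, hE⟩

/-- **An UNFORCED realisation's datum is not axisymmetric without swirl** (Ladyzhenskaya 1968 /
Ukhovskii–Yudovich 1968, DISCHARGED as `axisymmetric_no_swirl_global_regularity_holds`: the smooth,
divergence-free, rapidly decaying swirl-free datum has a global bounded-energy classical solution, which
`not_exists_global_classical` forbids). [cite: LemarieRieusset2016, Thm 10.4 (p. 285)] -/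
theorem not_axisym_noSwirl_of_force_zero (hν : 0 < ν) (hf : W.f = 0) :
    ¬ (IsAxisymmetric (W.u 0) ∧ HasNoSwirl (W.u 0)) := by
  rintro ⟨hA, hS⟩
  obtain ⟨u, p, hcl, hu0, hbe, -⟩ := axisymmetric_no_swirl_global_regularity_holds ν hν (W.u 0)
    W.contDiff_datum W.divFree_datum W.datum_decay hA hS
  refine W.not_exists_global_classical hν ⟨u, p, ?_, hu0, hbe⟩
  rw [hf]
  exact hcl

end Realisation

/-! ## §2 The lever against K2G: one globally solvable registered design -/

section Lever

/-- **K2G + ONE registered level-1 stage with a globally solvable design is absurd.** K2G glues the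
tower `Realisation.ofEpisodes` from the stage (same datum `S.u₀`, same force `S.f`); a global
finite-energy classical solution of that design contradicts `Realisation.not_exists_global_classical`.
No cap, no symmetry, no `hU`. [cite: Palasek2026ElementaryModel, §4] -/
theorem EpisodeInductionG.false_of_global_classical (h₂ : EpisodeInductionG)
    {S : Schedule TowerRates.wide} (hP : S.Pins 8 (6 / 5)) (hR : S.Rigid) (hQ : S.Quiet)
    (s₁ : Stage 1 TowerRates.wide S (Margins.routeG TowerRates.wide) 1)
    {v : ℝ → EuclideanSpace ℝ (Fin 3) → EuclideanSpace ℝ (Fin 3)}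
    {q : ℝ → EuclideanSpace ℝ (Fin 3) → ℝ}
    (hcl : IsClassicalNSSolutionOn (Ici 0) 1 S.f v q) (h0 : v 0 = S.u₀) (hE : HasBoundedEnergy v) :
    False := by
  have step : ∀ n, ∀ s : Stage 1 TowerRates.wide S (Margins.routeG TowerRates.wide) (n + 1),
      ∃ s' : Stage 1 TowerRates.wide S (Margins.routeG TowerRates.wide) (n + 1 + 1), s.Extends s' :=
    fun n s => h₂ S hP hR hQ (n + 1) (by omega) s
  have hf : (Realisation.ofEpisodes S s₁ step).f = S.f := Realisation.ofEpisodes_f S s₁ step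
  have hu : (Realisation.ofEpisodes S s₁ step).u 0 = S.u₀ := Realisation.ofEpisodes_u_zero S s₁ step
  refine (Realisation.ofEpisodes S s₁ step).not_exists_global_classical one_pos ⟨v, q, ?_, ?_, hE⟩
  · rw [hf]
    exact hcl
  · rw [hu, h0]

/-- **THE GLOBAL-SOLUTION LEVER (T2 ∀-form, parent level).** If SOME pinned (`Λ = 8`, `θ = 6/5`),
rigid, quiet wide schedule carries a registered (`Margins.routeG`) level-1 stage at unit viscosity AND its
design `(u₀, f)` has a global finite-energy classical solution, then K2G is false. Premise
empty-in-practice (K61); typed here so that a registered globally regular design, should one ever be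
exhibited, refutes the crux in one line. [cite: Palasek2026ElementaryModel, §4] -/
theorem not_episodeInductionG_of_global_design
    (h : ∃ (S : Schedule TowerRates.wide)
      (_ : Stage 1 TowerRates.wide S (Margins.routeG TowerRates.wide) 1)
      (v : ℝ → EuclideanSpace ℝ (Fin 3) → EuclideanSpace ℝ (Fin 3))
      (q : ℝ → EuclideanSpace ℝ (Fin 3) → ℝ),
      S.Pins 8 (6 / 5) ∧ S.Rigid ∧ S.Quiet ∧
      IsClassicalNSSolutionOn (Ici 0) 1 S.f v q ∧ v 0 = S.u₀ ∧ HasBoundedEnergy v) :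
    ¬ EpisodeInductionG := by
  rintro h₂
  obtain ⟨S, s₁, v, q, hP, hR, hQ, hcl, h0, hE⟩ := h
  exact h₂.false_of_global_classical hP hR hQ s₁ hcl h0 hE

/-- **K2G EMPTIES THE UNFORCED AXISYMMETRIC SWIRL-FREE CLASS AT LEVEL 1** (two-signed `ω_θ`
included): under K2G, a pinned rigid quiet wide schedule with force `f ≡ 0` and an axisymmetric
swirl-free datum carries NO registered level-1 stage — the glued tower would be an unforced realisation
with a swirl-free datum (`Realisation.not_axisym_noSwirl_of_force_zero`).
[cite: LemarieRieusset2016, Thm 10.4 (p. 285)] -/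
theorem EpisodeInductionG.isEmpty_stage_of_noSwirl (h₂ : EpisodeInductionG)
    {S : Schedule TowerRates.wide} (hP : S.Pins 8 (6 / 5)) (hR : S.Rigid) (hQ : S.Quiet)
    (hf : S.f = 0) (hA : IsAxisymmetric S.u₀) (hS : HasNoSwirl S.u₀) :
    IsEmpty (Stage 1 TowerRates.wide S (Margins.routeG TowerRates.wide) 1) := by
  refine ⟨fun s₁ => ?_⟩
  have step : ∀ n, ∀ s : Stage 1 TowerRates.wide S (Margins.routeG TowerRates.wide) (n + 1),
      ∃ s' : Stage 1 TowerRates.wide S (Margins.routeG TowerRates.wide) (n + 1 + 1), s.Extends s' :=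
    fun n s => h₂ S hP hR hQ (n + 1) (by omega) s
  have hWf : (Realisation.ofEpisodes S s₁ step).f = 0 := by
    rw [Realisation.ofEpisodes_f S s₁ step]
    exact hf
  have hu : (Realisation.ofEpisodes S s₁ step).u 0 = S.u₀ := Realisation.ofEpisodes_u_zero S s₁ step
  refine (Realisation.ofEpisodes S s₁ step).not_axisym_noSwirl_of_force_zero one_pos hWf ?_
  rw [hu]
  exact ⟨hA, hS⟩

/-- **The no-swirl lever, packaged**: ONE registered level-1 stage of an unforced pinned rigid quiet
wide schedule with axisymmetric swirl-free datum refutes K2G — fully kernel (regularity and uniqueness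
are theorems of the tree), no cap, no sign condition. Premise empty-in-practice (K61 / S-RING-1 /
P-RING-0). [cite: LemarieRieusset2016, Thm 10.4 (p. 285)] -/
theorem not_episodeInductionG_of_noSwirl_design
    (h : ∃ (S : Schedule TowerRates.wide)
      (_ : Stage 1 TowerRates.wide S (Margins.routeG TowerRates.wide) 1),
      S.Pins 8 (6 / 5) ∧ S.Rigid ∧ S.Quiet ∧ S.f = 0 ∧ IsAxisymmetric S.u₀ ∧ HasNoSwirl S.u₀) :
    ¬ EpisodeInductionG := by
  rintro h₂
  obtain ⟨S, s₁, hP, hR, hQ, hf, hA, hS⟩ := h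
  exact (h₂.isEmpty_stage_of_noSwirl hP hR hQ hf hA hS).false s₁

/-- **Clay (A) empties the UNFORCED design class under K2G.** If the summit statement
`NavierStokesRegularity` (Fefferman's (A): global smooth bounded-energy solutions for all smooth
divergence-free rapidly decaying data, `f ≡ 0`) holds, then under K2G no unforced pinned rigid quiet
wide schedule carries a registered level-1 stage: the ∀-binder is then vacuous on its unforced
sub-class. (A conditional bookkeeping remark; neither side is asserted.) [cite: FeffermanClay2006, (A)] -/
theorem EpisodeInductionG.isEmpty_unforced_stage_of_clayA
    (hA : _root_.NavierStokesRegularity) (h₂ : EpisodeInductionG)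
    {S : Schedule TowerRates.wide} (hP : S.Pins 8 (6 / 5)) (hR : S.Rigid) (hQ : S.Quiet)
    (hf : S.f = 0) :
    IsEmpty (Stage 1 TowerRates.wide S (Margins.routeG TowerRates.wide) 1) := by
  refine ⟨fun s₁ => ?_⟩
  have step : ∀ n, ∀ s : Stage 1 TowerRates.wide S (Margins.routeG TowerRates.wide) (n + 1),
      ∃ s' : Stage 1 TowerRates.wide S (Margins.routeG TowerRates.wide) (n + 1 + 1), s.Extends s' :=
    fun n s => h₂ S hP hR hQ (n + 1) (by omega) s
  set W := Realisation.ofEpisodes S s₁ step with hWdef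
  have hWf : W.f = 0 := by
    rw [hWdef, Realisation.ofEpisodes_f S s₁ step]
    exact hf
  obtain ⟨v, q, hv, hq, hns, hE⟩ :=
    hA 1 one_pos (W.u 0) W.contDiff_datum W.divFree_datum W.datum_decay
  refine W.not_exists_claySolution tao_unconditional_uniqueness_velocity_forced_holds one_pos
    ⟨v, q, hv, hq, ?_, hE⟩
  rw [hWf]
  exact hns

end Lever

/-! ## §3 The dichotomy one level up, and T2's point made kernel -/

/-- **`¬ K2G` proves the base item**: the dichotomy of record one level up from
`heredityAtOne_or_episodeBaseG` — K2G holds (vacuously or not) OR some pinned rigid quiet wide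
schedule carries a registered level-1 stage (a counterexample to K2G lives at some level `k ≥ 1`,
`exists_rungG_of_not_episodeInductionG`, and restricts to level 1, `RungG.episodeBaseG`). [folklore] -/
theorem episodeInductionG_or_episodeBaseG : EpisodeInductionG ∨ EpisodeBaseG := by
  refine (em EpisodeInductionG).imp_right fun h => ?_
  obtain ⟨k, hk, hR⟩ := exists_rungG_of_not_episodeInductionG h
  exact hR.episodeBaseG hk

/-- **T2's ∀-form point, kernel**: IF every registered level-1 design (pinned rigid quiet wide
schedule with a `routeG` stage at level 1, unit viscosity) had a global finite-energy classical
solution, THEN K2G would hold IFF VACUOUSLY — iff NO such design exists (`↔ ¬ EpisodeBaseG`). So a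
non-vacuous K2G presupposes a registered design WITHOUT global regularity, i.e. the route's blow-up
content sits entirely in the existence side. (Hypothesis and both sides unasserted.) [folklore] -/
theorem episodeInductionG_iff_not_episodeBaseG_of_global_designs
    (hreg : ∀ S : Schedule TowerRates.wide, S.Pins 8 (6 / 5) → S.Rigid → S.Quiet →
      Nonempty (Stage 1 TowerRates.wide S (Margins.routeG TowerRates.wide) 1) →
      ∃ (v : ℝ → EuclideanSpace ℝ (Fin 3) → EuclideanSpace ℝ (Fin 3))
        (q : ℝ → EuclideanSpace ℝ (Fin 3) → ℝ),
        IsClassicalNSSolutionOn (Ici 0) 1 S.f v q ∧ v 0 = S.u₀ ∧ HasBoundedEnergy v) :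
    EpisodeInductionG ↔ ¬ EpisodeBaseG := by
  constructor
  · rintro h₂ ⟨S, hP, hR, hQ, ⟨s₁⟩⟩
    obtain ⟨v, q, hcl, h0, hE⟩ := hreg S hP hR hQ ⟨s₁⟩
    exact h₂.false_of_global_classical hP hR hQ s₁ hcl h0 hE
  · intro h₁
    exact episodeInductionG_or_episodeBaseG.resolve_right h₁

end Summit.NavierStokesRegularity.FluidComputer.PalasekTowerClayBridge

/-! ## §4 By the route's item names (`Theses/PalasekTowerBreakdown.lean`) -/

namespace Summit.NavierStokesRegularity.PalasekTowerBreakdownNegative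

open Set
open Summit.NavierStokesRegularity.NavierStokesRegularity.Theses
open Summit.NavierStokesRegularity.FluidComputer.PalasekTowerClayBridge
open Literature.Analysis.FluidPDE

/-- **Item 19178 `PalasekTowerBreakdown.EpisodeInduction` is refuted by any registered level-1 design
with a global finite-energy classical solution** (route decl by name; body
`not_episodeInductionG_of_global_design`). Premise empty-in-practice (K61). [cite: Palasek2026ElementaryModel, §4] -/
theorem palasekTowerBreakdown_not_episodeInduction_of_global_design
    (h : ∃ (S : Schedule TowerRates.wide)
      (_ : Stage 1 TowerRates.wide S (Margins.routeG TowerRates.wide) 1)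
      (v : ℝ → EuclideanSpace ℝ (Fin 3) → EuclideanSpace ℝ (Fin 3))
      (q : ℝ → EuclideanSpace ℝ (Fin 3) → ℝ),
      S.Pins 8 (6 / 5) ∧ S.Rigid ∧ S.Quiet ∧
      IsClassicalNSSolutionOn (Ici 0) 1 S.f v q ∧ v 0 = S.u₀ ∧ HasBoundedEnergy v) :
    ¬ PalasekTowerBreakdown.EpisodeInduction :=
  not_episodeInductionG_of_global_design h

/-- **Item 19178 is refuted by any registered UNFORCED axisymmetric swirl-free level-1 design**
(route decl by name; body `not_episodeInductionG_of_noSwirl_design`; Ladyzhenskaya / Ukhovskii–Yudovich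
discharged in the tree). Premise empty-in-practice (K61 / S-RING-1). [cite: LemarieRieusset2016, Thm 10.4 (p. 285)] -/
theorem palasekTowerBreakdown_not_episodeInduction_of_noSwirl_design
    (h : ∃ (S : Schedule TowerRates.wide)
      (_ : Stage 1 TowerRates.wide S (Margins.routeG TowerRates.wide) 1),
      S.Pins 8 (6 / 5) ∧ S.Rigid ∧ S.Quiet ∧ S.f = 0 ∧ IsAxisymmetric S.u₀ ∧ HasNoSwirl S.u₀) :
    ¬ PalasekTowerBreakdown.EpisodeInduction :=
  not_episodeInductionG_of_noSwirl_design h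

/-- **… hence such a design breaks the heredity PAIR of `closes`** (items 19249 ∧ 19250, through the
route's glue `EpisodeInductionGlueBy_holds`; which conjunct fails is not decided here).
[cite: LemarieRieusset2016, Thm 10.4 (p. 285)] -/
theorem palasekTowerBreakdown_not_heredity_pair_of_noSwirl_design
    (h : ∃ (S : Schedule TowerRates.wide)
      (_ : Stage 1 TowerRates.wide S (Margins.routeG TowerRates.wide) 1),
      S.Pins 8 (6 / 5) ∧ S.Rigid ∧ S.Quiet ∧ S.f = 0 ∧ IsAxisymmetric S.u₀ ∧ HasNoSwirl S.u₀) :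
    ¬ (PalasekTowerBreakdown.HeredityAtOne ∧ PalasekTowerBreakdown.HeredityFromTwo) := by
  rintro ⟨h₁, h₂⟩
  exact palasekTowerBreakdown_not_episodeInduction_of_noSwirl_design h
    (PalasekTowerBreakdown.EpisodeInductionGlueBy_holds h₁ h₂)

end Summit.NavierStokesRegularity.PalasekTowerBreakdownNegative

end
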